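import Summits.AtomisticToContinuum.Crystallization.Theorems.OverbindingBudgetRegistryDichotomy

/-!
# OverbindingBudget · decomp-a2c lens-4 g33 — part XXI-R: the cell normal form of slot 7d in the REFERENCE-CENTRED currency (`BasalReferenceCW`)

Helper file under `--supports stmt-AtomisticToContinuum-31280` (RDEF = `Theses.OverbindingBudget.RobustDefectLimitWindows`); closes nothing.

Part XXI-D cut slot 7d `BasalReferenceW Λ₁ ρ₁` (currency W′ of the cone of record `…_pinning_convexW'`).  lens-3's reference-centred 7c′ chain
((s)(t)(y): `TubeConvexRef Λ₁ ρ₀`, census objects = references) prices the reference slot as 7d″ `BasalReferenceCW Λ₁ ρ₁` = `BasalReferenceW` + the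
reference's own two-shell cleanliness `IsCleanW (μS (Layered a b w′))` (tree: `…StackedRigidityRef`, cones `…_pinning_uniqRef` / `…_pinning_convexRef`).
This file makes the T/S dichotomy CURRENCY-INDEPENDENT: the two PATTERN leaves are strengthened to conclude `UniformlyClean ∧ IsCleanW`
(R5⁺ `RegistryMetricCW`, SqR5⁺ `SqRegistryMetricCW` — still pure lattice geometry of explicit profiles: the registry references are near-Barlow /
near-fcc{100} lattices with ≤ 2 % distortion against `IsCleanW`'s pattern tolerance `1/16`), the forgetful seams to R5 / SqR5 are PROVED, and the ★
seam `basalReferenceCW_of_dichotomy` + the cones `…_pinning_uniqRef_dichotomy`, `…_pinning_convexRef_dichotomy` and the leaf-cut literal corollary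
`rdef_twentieth_of_recordK_ref` (7c‴ := `TubeConvexRef (17/16) (1/40)`, same literals as XXI-D) are PROVED.  Whichever currency the critic rules of
record (W′ or Ref), the cut beneath the reference slot is R4T ∧ R4S ∧ R3geo ∧ BalancedLocus ∧ R1 ∧ R2 ∧ R5(⁺) ∧ SqR3geo ∧ SqBalancedHeight ∧ SqR5(⁺).
-/

noncomputable section

namespace Summit.AtomisticToContinuum.Crystallization.Theorems.OverbindingBudgetRegistryDichotomyCW

open Metric
open scoped RealInnerProductSpace
open Summit.AtomisticToContinuum.Crystallization.Theses.OverbindingBudget (RobustDefectLimitWindows)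
open Summit.AtomisticToContinuum.Crystallization.Theses.PricedLinkCensus (ChargedEnergyGap)
open Summit.AtomisticToContinuum.Crystallization.Theorems.OverbindingBudgetGradedBareness (CleanlessExcessT)
open Summit.AtomisticToContinuum.Crystallization.Theorems.OverbindingBudgetCoherentCut (CoherentResidual)
open Summit.AtomisticToContinuum.Crystallization.Theorems.OverbindingBudgetUniformCutStatements (GrossCleanBallsU)
open Summit.AtomisticToContinuum.Crystallization.Theorems.OverbindingBudgetElasticSplitScale (CompressedVirialLaw)
open Summit.AtomisticToContinuum.Crystallization.Theorems.OverbindingBudgetElasticSplitShear (StressFree)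
open Summit.AtomisticToContinuum.Crystallization.Theorems.ChartedPlanarOrderChunkFloor (E3)
open Summit.AtomisticToContinuum.Crystallization.Theorems.ChartedPlanarOrderRigidityDoor (IsNash)
open Summit.AtomisticToContinuum.Crystallization.Theorems.ChartedPlanarOrderDensityDichotomy (μS IsSep)
open Summit.AtomisticToContinuum.Crystallization.Theorems.ChartedPlanarOrderDoorLayered (Layered)
open Summit.AtomisticToContinuum.Crystallization.Theorems.ChartedPlanarOrderProfileSlavingLJ (IsStacked gapStress incr tube)
open Summit.AtomisticToContinuum.Crystallization.Theorems.ChartedPlanarOrderTubeConvex (TubeConvexRef tubeUniquenessRef_of_tubeConvexRef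
  rdef_of_grossU_shape_gluing_pinning_convexRef)
open Summit.AtomisticToContinuum.Crystallization.Theorems.OverbindingBudgetPeriodicCleanOrStrained (UniformlyClean)
open Summit.AtomisticToContinuum.Crystallization.Theorems.OverbindingBudgetScaleWidening (IsCleanW DoorPeriodicW)
open Summit.AtomisticToContinuum.Crystallization.Theorems.OverbindingBudgetTwoShellShape (TwoShellShape BarlowGluingW)
open Summit.AtomisticToContinuum.Crystallization.Theorems.OverbindingBudgetStackedRigidityW (StackedReductionW GapStressVanishesW)
open Summit.AtomisticToContinuum.Crystallization.Theorems.OverbindingBudgetStackedRigidityRef (RegistryPinningW BasalReferenceCW)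
open Summit.AtomisticToContinuum.Crystallization.Theorems.OverbindingBudgetStackedRigidityUniq (TubeUniquenessRef
  rdef_of_grossU_shape_gluing_pinning_uniqRef)
open Summit.AtomisticToContinuum.Crystallization.Theorems.OverbindingBudgetRegistryCut (unifStress IsUnitNormal IsBalanced reg Pinned
  RegistryLocalisationW RegistryResidual RegistryTube RegistryMetric RegistryZeroExists isStacked_of_near_reg exists_profile_of_incr
  zeroExists_of_residual_tube)
open Summit.AtomisticToContinuum.Crystallization.Theorems.OverbindingBudgetRegistrySquare (holSq IsSqBalanced regSq PinnedSq
  isStacked_of_near_regSq gapStress_regSq)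
open Summit.AtomisticToContinuum.Crystallization.Theorems.OverbindingBudgetRegistryDichotomy (CellPinningT CellPinningS CellPinningDichotomyW
  RegistryGeometryW BalancedLocus SqRegistryLocalisationW SqRegistryGeometryW SqBalancedHeight SqRegistryMetric cellPinningDichotomyW_of_TS
  registryLocalisationW_of_geometry_locus sqRegistryLocalisationW_of_geometry_height)

/-! ## §1 The PATTERN leaves in the reference-centred currency -/

/-- **R5⁺ · `RegistryMetricCW s₁ s₂ r″`** — R5 `RegistryMetric` with the reference's two-shell cleanliness added: an offset profile whose increments
are within `r″` of a two-valued balanced registry profile over a pinned near-triangular cell generates a layered set that is UNIFORMLY CLEAN and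
`IsCleanW`.  Why it might fail: as R5 (12 bonds within `2 %` of one `a′ ∈ [47/50, 1]`, gap to `1.26 a′`); the `IsCleanW` conjunct has slack
(pattern tolerance `1/16` against `≤ 2 %` distortion + `r″ = 3/500`). [PATTERN] [piece] -/
def RegistryMetricCW (s₁ s₂ r'' : ℝ) : Prop :=
  ∀ (a b n c : E3) (σ : ℤ → Bool) (u v : ℤ → ℤ), Pinned s₁ s₂ a b → IsUnitNormal a b n → IsBalanced a b n c →
    ∀ w' : ℤ → E3, (∀ k : ℤ, ‖incr w' k - reg a b n c σ u v k‖ ≤ r'') →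
      UniformlyClean (Layered a b w') ∧ IsCleanW (μS (Layered a b w'))

/-- **SqR5⁺ · `SqRegistryMetricCW t₁ t₂ h₁ τ r″`** — SqR5 `SqRegistryMetric` with `IsCleanW` of the reference added (square-hollow-centred one-valued
registry profile, height within `τ` of `h₁`, over a pinned near-square cell).  Why it might fail: as SqR5 (of record `(τ, r″) = (1/100, 0)`); the
`IsCleanW` conjunct: the lattice is fcc{100}-like with `≤ 1.5 %` distortion against tolerance `1/16`. [PATTERN·S] [piece] -/
def SqRegistryMetricCW (t₁ t₂ h₁ τ r'' : ℝ) : Prop :=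
  ∀ (a b n c : E3) (u v : ℤ → ℤ), PinnedSq t₁ t₂ a b → IsUnitNormal a b n → c - ⟪c, n⟫ • n = holSq a b → |⟪c, n⟫ - h₁| ≤ τ →
    ∀ w' : ℤ → E3, (∀ k : ℤ, ‖incr w' k - regSq a b c u v k‖ ≤ r'') →
      UniformlyClean (Layered a b w') ∧ IsCleanW (μS (Layered a b w'))

/-- Forgetful seam `RegistryMetricCW → RegistryMetric`. [this file] -/
theorem registryMetric_of_CW {s₁ s₂ r'' : ℝ} (h : RegistryMetricCW s₁ s₂ r'') : RegistryMetric s₁ s₂ r'' :=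
  fun a b n c σ u v hp hn hbal w' hw' => (h a b n c σ u v hp hn hbal w' hw').1

/-- Forgetful seam `SqRegistryMetricCW → SqRegistryMetric`. [this file] -/
theorem sqRegistryMetric_of_CW {t₁ t₂ h₁ τ r'' : ℝ} (h : SqRegistryMetricCW t₁ t₂ h₁ τ r'') : SqRegistryMetric t₁ t₂ h₁ τ r'' :=
  fun a b n c u v hp hn hlat hhgt w' hw' => (h a b n c u v hp hn hlat hhgt w' hw').1

/-! ## §2 The seam in the reference-centred currency (PROVED) -/

/-- ★ **TWENTIETH seam, reference-centred**: `CellPinningDichotomyW → RegistryLocalisationW r′ → RegistryZeroExists r″ → RegistryMetricCW r″ →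
SqRegistryLocalisationW h₁ τ rₛ → SqRegistryMetricCW h₁ τ rₛ″ → BasalReferenceCW Λ₁ ρ₁` for `r″ < 1/2`, `r′ + r″ ≤ ρ₁`, `0 ≤ rₛ″`, `rₛ ≤ ρ₁`
(XXI-D's proof with the references' `IsCleanW` carried along). [this file] -/
theorem basalReferenceCW_of_dichotomy {Λ₁ s₁ s₂ t₁ t₂ r' r'' h₁ τ rₛ rₛ'' ρ₁ : ℝ} (hr'' : r'' < 1 / 2) (hρ₁ : r' + r'' ≤ ρ₁) (hrₛ'' : 0 ≤ rₛ'')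
    (hrₛ : rₛ ≤ ρ₁) (hPin : CellPinningDichotomyW Λ₁ s₁ s₂ t₁ t₂) (hLoc : RegistryLocalisationW Λ₁ s₁ s₂ r')
    (hEx : RegistryZeroExists s₁ s₂ r'') (hMet : RegistryMetricCW s₁ s₂ r'') (hSqLoc : SqRegistryLocalisationW Λ₁ t₁ t₂ h₁ τ rₛ)
    (hSqMet : SqRegistryMetricCW t₁ t₂ h₁ τ rₛ'') : BasalReferenceCW Λ₁ ρ₁ := by
  intro δ hδ a b w hst hab ha hb hs hc hna hf hz
  rcases hPin δ hδ a b w hst hab ha hb hs hc hna hf hz with hp | hp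
  · obtain ⟨n, c, σ, u, v, hn, hbal, hloc⟩ := hLoc δ hδ a b w hst hab ha hb hs hc hna hf hz hp
    obtain ⟨h, hh, hz'⟩ := hEx a b n c σ u v hp hn hbal
    obtain ⟨w', hw'⟩ := exists_profile_of_incr h
    have hh' : ∀ k, ‖incr w' k - reg a b n c σ u v k‖ ≤ r'' := fun k => by rw [hw']; exact hh k
    refine ⟨w', isStacked_of_near_reg hn hbal.1 hh' hr'', fun m => ?_, fun m => by rw [hw']; exact hz' m,
      (hMet a b n c σ u v hp hn hbal w' hh').1, (hMet a b n c σ u v hp hn hbal w' hh').2⟩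
    rw [tube, mem_closedBall, dist_eq_norm]
    calc ‖incr w' m - incr w m‖ ≤ ‖incr w' m - reg a b n c σ u v m‖ + ‖incr w m - reg a b n c σ u v m‖ := by
          rw [← norm_neg (incr w m - reg a b n c σ u v m), neg_sub]
          exact norm_sub_le_norm_sub_add_norm_sub _ _ _
      _ ≤ r'' + r' := add_le_add (hh' m) (hloc m)
      _ ≤ ρ₁ := by linarith
  · obtain ⟨n, c, u, v, hn, hbal, hhgt, hloc⟩ := hSqLoc δ hδ a b w hst hab ha hb hs hc hna hf hz hp
    obtain ⟨w', hw'⟩ := exists_profile_of_incr (regSq a b c u v)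
    have h0 : ∀ k, ‖incr w' k - regSq a b c u v k‖ ≤ 0 := fun k => by rw [hw', sub_self, norm_zero]
    have hcl := hSqMet a b n c u v hp hn hbal.2.1 hhgt w' fun k => (h0 k).trans hrₛ''
    refine ⟨w', isStacked_of_near_regSq hn hbal.1 h0 one_half_pos, fun m => ?_, fun m => by rw [hw', gapStress_regSq]; exact hbal.2.2,
      hcl.1, hcl.2⟩
    rw [tube, mem_closedBall, dist_eq_norm, hw', ← norm_neg, neg_sub]
    exact (hloc m).trans hrₛ

/-! ## §3 The cones in the reference-centred currency -/

/-- ★ **RDEF cone, twentieth form, reference-centred, uniqueness-fed** (`…_pinning_uniqRef` with 7d″ so cut). [this file] -/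
theorem rdef_of_grossU_shape_gluing_pinning_uniqRef_dichotomy (Λ Λ₁ ρ₀ ρ₁ s₁ s₂ t₁ t₂ r' r'' h₁ τ rₛ rₛ'' : ℝ) (hr'' : r'' < 1 / 2)
    (hρ₁ : r' + r'' ≤ ρ₁) (hrₛ'' : 0 ≤ rₛ'') (hrₛ : rₛ ≤ ρ₁)
    (hG : GrossCleanBallsU (1 / 250) 10) (hCEG : ChargedEnergyGap) (hC : CompressedVirialLaw (1 / 250) 10)
    (hS : TwoShellShape (1 / 100) (3 / 50) (1 / 450)) (hB₂ : BarlowGluingW) (hD : DoorPeriodicW Λ) (hSR : StackedReductionW Λ Λ₁)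
    (hV : GapStressVanishesW Λ₁) (hP : RegistryPinningW Λ₁ ρ₀ ρ₁) (hU : TubeUniquenessRef Λ₁ ρ₀) (hPin : CellPinningDichotomyW Λ₁ s₁ s₂ t₁ t₂)
    (hLoc : RegistryLocalisationW Λ₁ s₁ s₂ r') (hEx : RegistryZeroExists s₁ s₂ r'') (hMet : RegistryMetricCW s₁ s₂ r'')
    (hSqLoc : SqRegistryLocalisationW Λ₁ t₁ t₂ h₁ τ rₛ) (hSqMet : SqRegistryMetricCW t₁ t₂ h₁ τ rₛ'')
    (hCE : CleanlessExcessT) (hRes : CoherentResidual 10) : RobustDefectLimitWindows :=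
  rdef_of_grossU_shape_gluing_pinning_uniqRef Λ Λ₁ ρ₀ ρ₁ hG hCEG hC hS hB₂ hD hSR hV hP hU
    (basalReferenceCW_of_dichotomy hr'' hρ₁ hrₛ'' hrₛ hPin hLoc hEx hMet hSqLoc hSqMet) hCE hRes

/-- ★ **RDEF cone, twentieth form, reference-centred, CONVEX-FED** (7c‴ := lens-3's `TubeConvexRef Λ₁ ρ₀` via `…_pinning_convexRef`; lens-3's (y)
feeds it from `TubeConvexityRef` / `TubeChannelsRef` for `Λ₁ ≤ 17/16`, `ρ₀ < 19/50`). [this file] -/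
theorem rdef_of_grossU_shape_gluing_pinning_convexRef_dichotomy (Λ Λ₁ ρ₀ ρ₁ s₁ s₂ t₁ t₂ r' r'' h₁ τ rₛ rₛ'' : ℝ) (hr'' : r'' < 1 / 2)
    (hρ₁ : r' + r'' ≤ ρ₁) (hrₛ'' : 0 ≤ rₛ'') (hrₛ : rₛ ≤ ρ₁)
    (hG : GrossCleanBallsU (1 / 250) 10) (hCEG : ChargedEnergyGap) (hC : CompressedVirialLaw (1 / 250) 10)
    (hS : TwoShellShape (1 / 100) (3 / 50) (1 / 450)) (hB₂ : BarlowGluingW) (hD : DoorPeriodicW Λ) (hSR : StackedReductionW Λ Λ₁)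
    (hV : GapStressVanishesW Λ₁) (hP : RegistryPinningW Λ₁ ρ₀ ρ₁) (hT : TubeConvexRef Λ₁ ρ₀) (hPin : CellPinningDichotomyW Λ₁ s₁ s₂ t₁ t₂)
    (hLoc : RegistryLocalisationW Λ₁ s₁ s₂ r') (hEx : RegistryZeroExists s₁ s₂ r'') (hMet : RegistryMetricCW s₁ s₂ r'')
    (hSqLoc : SqRegistryLocalisationW Λ₁ t₁ t₂ h₁ τ rₛ) (hSqMet : SqRegistryMetricCW t₁ t₂ h₁ τ rₛ'')
    (hCE : CleanlessExcessT) (hRes : CoherentResidual 10) : RobustDefectLimitWindows :=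
  rdef_of_grossU_shape_gluing_pinning_convexRef Λ Λ₁ ρ₀ ρ₁ hG hCEG hC hS hB₂ hD hSR hV hP hT
    (basalReferenceCW_of_dichotomy hr'' hρ₁ hrₛ'' hrₛ hPin hLoc hEx hMet hSqLoc hSqMet) hCE hRes

/-- ★ **the twentieth cone at the numbers of record, reference-centred, LEAF-CUT** (`(Λ, Λ₁; ρ₀, ρ₁) = (2, 17/16; 1/40, 3/16)`; `(ε, r, μ; r″) =
(1/250, 1/100, 1; 3/500)`; T `(τ₀, τ) = (3/20, 1/40)`; S `(τ₀, τ, rₛ, rₛ″) = (3/20, 1/100, 4/25, 0)`; 7c‴ := `TubeConvexRef (17/16) (1/40)`).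
Leaves: slots 1–6, 7a, 7b, 7c″, 7c‴ and, for 7d″, R4T ∧ R4S ∧ R3geo ∧ `BalancedLocus` ∧ R1 ∧ R2 ∧ R5⁺ ∧ SqR3geo ∧ `SqBalancedHeight` ∧ SqR5⁺;
slots 8, 9. [this file] -/
theorem rdef_twentieth_of_recordK_ref (s₁ s₂ t₁ t₂ h₀ h₁ : ℝ) (hG : GrossCleanBallsU (1 / 250) 10) (hCEG : ChargedEnergyGap)
    (hC : CompressedVirialLaw (1 / 250) 10) (hS : TwoShellShape (1 / 100) (3 / 50) (1 / 450)) (hB₂ : BarlowGluingW) (hD : DoorPeriodicW 2)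
    (hSR : StackedReductionW 2 (17 / 16)) (hV : GapStressVanishesW (17 / 16)) (hP : RegistryPinningW (17 / 16) (1 / 40) (3 / 16))
    (hT : TubeConvexRef (17 / 16) (1 / 40)) (hPinT : CellPinningT (17 / 16) s₁ s₂) (hPinS : CellPinningS (17 / 16) t₁ t₂)
    (hGeo : RegistryGeometryW (17 / 16) s₁ s₂ h₀ (3 / 20)) (hBal : BalancedLocus s₁ s₂ h₀ (1 / 40)) (hR1 : RegistryResidual s₁ s₂ (1 / 250))
    (hR2 : RegistryTube s₁ s₂ (1 / 100) 1) (hMet : RegistryMetricCW s₁ s₂ (3 / 500))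
    (hSqGeo : SqRegistryGeometryW (17 / 16) t₁ t₂ h₁ (3 / 20)) (hSqH : SqBalancedHeight t₁ t₂ h₁ (1 / 100))
    (hSqMet : SqRegistryMetricCW t₁ t₂ h₁ (1 / 100) 0) (hCE : CleanlessExcessT) (hRes : CoherentResidual 10) : RobustDefectLimitWindows :=
  rdef_of_grossU_shape_gluing_pinning_convexRef_dichotomy 2 (17 / 16) (1 / 40) (3 / 16) s₁ s₂ t₁ t₂ (7 / 40) (3 / 500) h₁ (1 / 100) (4 / 25) 0
    (by norm_num) (by norm_num) le_rfl (by norm_num) hG hCEG hC hS hB₂ hD hSR hV hP hT (cellPinningDichotomyW_of_TS le_rfl hPinT hPinS)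
    (registryLocalisationW_of_geometry_locus (by norm_num) hGeo hBal)
    (zeroExists_of_residual_tube (by norm_num) (by norm_num) (by norm_num) (by norm_num) (by norm_num) (by norm_num) hR1 hR2) hMet
    (sqRegistryLocalisationW_of_geometry_height (by norm_num) hSqGeo hSqH) hSqMet hCE hRes

end Summit.AtomisticToContinuum.Crystallization.Theorems.OverbindingBudgetRegistryDichotomyCW

end
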